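import Summits.BirchSwinnertonDyer.BirchSwinnertonDyer.Theorems.ResidualThetaTransportAtTwoResidualSignedLambdaLowerCMAtTwoColemanPlusHomTwoCoeff
import HarnessLib

/-!
# `Col⁺ ⊗ 𝒪` at `p = 2` is `Λ`-LINEAR: the plus Coleman map intertwines precomposition with `g⁻¹` on functionals and multiplication by
# `1 + T` on `𝒪⟦T⟧` (functional model; the `Λ_𝒪`-structure clause of STUB-PLAN rev 7 stub 1)

Route `ResidualThetaTransportAtTwo` (RTT), crux RSL_g `ResidualSignedLambdaLowerCMAtTwo` (stmt-BirchSwinnertonDyer-22608; the (R≥)ᵖ crux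
stmt-BirchSwinnertonDyer-26074 is glue above it), DAG node N1 ⊗ 𝒪. Seat `prover-bsd-wall-rtt-p2` g16 (`--supports`, closes nothing). Sequel of
`…ColemanPlusHomTwoCoeff` (the plus Coleman value as one named `𝒪`-linear surjection `col`, PINNED by the congruences). THEOREMS ONLY (no
definition, no named fact, no instance, no `sorry`); BSD is not proved by any of this; 22608 / 26074 OPEN.

WHAT. The `Λ = 𝒪⟦T⟧`-module structure on the functionals `Hom(E(ℚ_{2,∞}·ℚ_v), 𝒪)` is `(1+T)·z = z ∘ g⁻¹` (Sprung 2012 §5, Kobayashi §8: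
`γ` acts on `Hom` contragrediently). §1 proves the ORBIT-SUM identity behind it over any commutative ring:
`Σ_{j<N} C(z(g^{j-1}x))(X+1)^j = (X+1)·Σ_{j<N} C(z(gʲx))(X+1)^j − C(z(g^{N-1}x))·((X+1)^N − 1)` when `g^N x = x` (`orbitPoly_precomp_inv`;
the wrap-around term is a multiple of `ω = (X+1)^N − 1`), hence «`L` a plus value of `z` ⇒ `(1+X)·L` a plus value of `z ∘ g⁻¹`»
(`plusCongr_precomp_inv`). §2 reads it on the pinned map of `exists_colemanPlusHom_coeff_two`: **`exists_colemanPlusHom_coeff_two_twist`** —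
the same `col` satisfies in addition `col (z ∘ g⁻¹) = (1 + X) · col z` for every functional `z`, i.e. `col` is `Λ_𝒪`-linear for
`T ↦ (z ↦ z ∘ g⁻¹ − z)`; so `Hom(E(ℚ_{2,∞}·ℚ_v), 𝒪)/ann(E⁺_∞) ≅ Λ_𝒪` as `Λ_𝒪`-MODULES (Kobayashi Thm. 6.2 with coefficients at `2`).

References: [Kobayashi2003] Thm. 6.2, §8 (8.20)–(8.23); [Sprung2012] §5 (Def. 5.9), Prop. 7.3; the tree's `SignedColemanImage.exists_pairingSum_twist`
(the `ℤ₂`-valued twin of §1).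
-/

set_option autoImplicit false
-- the Theorems namespace of this sub repeats the summit name by design (D-0017 nested layout)
set_option linter.dupNamespace false

noncomputable section

open scoped Classical
open Polynomial Finset

namespace Summit.BirchSwinnertonDyer.BirchSwinnertonDyer.Theorems.SignedColemanImage

open Literature.NumberTheory.EllipticCurves Literature.NumberTheory.EllipticCurves.Kobayashi2003 Function

universe u

/-! ## §1 The orbit-sum identity under `z ↦ z ∘ g⁻¹` -/

section Orbit

variable {G : Type*} [Group G] {V : Type*} [AddCommGroup V] [MulAction G V] (A : AddSubgroup V)
  (hAinv : ∀ (g : G) (a : V), a ∈ A → g • a ∈ A) {O : Type*} [CommRing O]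

/-- **The orbit-sum identity for the contragredient shift** (`ℤ`-free form of the tree's `exists_pairingSum_twist`): for `g^N • x = x`
(`N ≥ 1`), all `gʲ • x ∈ A`, and an `𝒪`-valued functional `z` on `A`,
`Σ_{j<N} C(z(g⁻¹gʲx))(X+1)^j = (X+1)·Σ_{j<N} C(z(gʲx))(X+1)^j − C(z(g^{N-1}x))·((X+1)^N − 1)`.
[cite: Kobayashi2003, §8 (8.20)–(8.23) (pp. 17–18)] [cite: Sprung2012, §5 Def. 5.9] -/
theorem orbitPoly_precomp_inv (g : G) {N : ℕ} (hN : 0 < N) (x : V) (hx : g ^ N • x = x) (hxA : ∀ j : ℕ, g ^ j • x ∈ A)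
    (z : A →+ O) :
    (∑ j ∈ range N, C (z ⟨g⁻¹ • g ^ j • x, hAinv _ _ (hxA j)⟩) * (X + 1) ^ j : O[X]) =
      (X + 1) * (∑ j ∈ range N, C (z ⟨g ^ j • x, hxA j⟩) * (X + 1) ^ j) -
        C (z ⟨g ^ (N - 1) • x, hxA (N - 1)⟩) * ((X + 1) ^ N - 1) := by
  obtain ⟨n, rfl⟩ : ∃ n, N = n + 1 := ⟨N - 1, by omega⟩
  simp only [Nat.add_sub_cancel]
  -- the shifted points: `g⁻¹ • g^{j+1} • x = g^j • x`, `g⁻¹ • x = g^n • x`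
  have hshift : ∀ j : ℕ, (⟨g⁻¹ • g ^ (j + 1) • x, hAinv _ _ (hxA (j + 1))⟩ : A) = ⟨g ^ j • x, hxA j⟩ := fun j ↦
    Subtype.ext (by simp only; rw [smul_smul, pow_succ', inv_mul_cancel_left])
  have hzero : (⟨g⁻¹ • g ^ 0 • x, hAinv _ _ (hxA 0)⟩ : A) = ⟨g ^ n • x, hxA n⟩ := Subtype.ext (by
    simp only [pow_zero, one_smul]
    conv_lhs => rw [← hx]
    rw [smul_smul, pow_succ', inv_mul_cancel_left])
  rw [Finset.sum_range_succ' (fun j ↦ C (z ⟨g⁻¹ • g ^ j • x, hAinv _ _ (hxA j)⟩) * (X + 1) ^ j), hzero, pow_zero, mul_one,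
    Finset.sum_congr rfl fun j _ ↦ by rw [hshift j], Finset.mul_sum,
    Finset.sum_range_succ (fun j ↦ (X + 1) * (C (z ⟨g ^ j • x, hxA j⟩) * (X + 1) ^ j))]
  have : ∀ j ∈ range n, (X + 1 : O[X]) * (C (z ⟨g ^ j • x, hxA j⟩) * (X + 1) ^ j) = C (z ⟨g ^ j • x, hxA j⟩) * (X + 1) ^ (j + 1) :=
    fun j _ ↦ by ring
  rw [Finset.sum_congr rfl this]
  ring

/-- **Plus values shift by `1+X` under `z ↦ z ∘ g⁻¹`**: if `L` satisfies the plus congruences for `z` at the orbit of `x` (`g^N x = x`,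
`Ω = (X+1)^N − 1`), then `(1+X)·L` satisfies them for the functional `a ↦ z(g⁻¹a)`.
[cite: Kobayashi2003, §8 (8.20)–(8.23) (pp. 17–18)] [cite: Sprung2012, Prop. 7.3] -/
theorem plusCongr_precomp_inv (g : G) {N : ℕ} (hN : 0 < N) (x : V) (hx : g ^ N • x = x) (hxA : ∀ j : ℕ, g ^ j • x ∈ A)
    (z z' : A →+ O) (hz' : ∀ a : A, z' a = z ⟨g⁻¹ • (a : V), hAinv _ _ a.2⟩) (s L : PowerSeries O)
    (h : (((X + 1) ^ N - 1 : O[X]) : PowerSeries O) ∣ ((∑ j ∈ range N, C (z ⟨g ^ j • x, hxA j⟩) * (X + 1) ^ j : O[X]) : PowerSeries O) + s * L) :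
    (((X + 1) ^ N - 1 : O[X]) : PowerSeries O) ∣
      ((∑ j ∈ range N, C (z' ⟨g ^ j • x, hxA j⟩) * (X + 1) ^ j : O[X]) : PowerSeries O) + s * ((1 + PowerSeries.X) * L) := by
  have hsum : (∑ j ∈ range N, C (z' ⟨g ^ j • x, hxA j⟩) * (X + 1) ^ j : O[X]) =
      ∑ j ∈ range N, C (z ⟨g⁻¹ • g ^ j • x, hAinv _ _ (hxA j)⟩) * (X + 1) ^ j :=
    Finset.sum_congr rfl fun j _ ↦ by rw [hz']
  have hcoe : ((∑ j ∈ range N, C (z' ⟨g ^ j • x, hxA j⟩) * (X + 1) ^ j : O[X]) : PowerSeries O) =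
      (1 + PowerSeries.X) * ((∑ j ∈ range N, C (z ⟨g ^ j • x, hxA j⟩) * (X + 1) ^ j : O[X]) : PowerSeries O) -
        PowerSeries.C (z ⟨g ^ (N - 1) • x, hxA (N - 1)⟩) * (((X + 1) ^ N - 1 : O[X]) : PowerSeries O) := by
    rw [hsum, orbitPoly_precomp_inv A hAinv g hN x hx hxA z]
    simp only [Polynomial.coe_sub, Polynomial.coe_mul, Polynomial.coe_add, Polynomial.coe_pow, Polynomial.coe_X, Polynomial.coe_one,
      Polynomial.coe_C]
    ring
  rw [hcoe]
  obtain ⟨q, hq⟩ := h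
  exact ⟨(1 + PowerSeries.X) * q - PowerSeries.C (z ⟨g ^ (N - 1) • x, hxA (N - 1)⟩), by linear_combination (1 + PowerSeries.X) * hq⟩

end Orbit

/-! ## §2 The pinned plus Coleman map at `2` intertwines `z ↦ z ∘ g⁻¹` with `1 + X` -/

section Two

open NumberField IsDedekindDomain WeierstrassCurve Literature.NumberTheory.EllipticCurves.Rank1Residual

variable (W : WeierstrassCurve ℚ) [W.IsElliptic] [W.IsGloballyMinimal]

/-- **`Col⁺ ⊗ 𝒪` at `2` is `Λ_𝒪`-linear** (functional model). As `exists_colemanPlusHom_coeff_two` (plus Honda family `(g, d)`, and for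
every `𝒪` finite free over `ℤ₂` and a domain an `𝒪`-linear surjection `col : Hom(E(ℚ_{2,∞}·ℚ_v), 𝒪) → 𝒪⟦T⟧` pinned by the plus
congruences with kernel `ann(E⁺_∞)`), AND: for all functionals `z, z'` with `z' = z ∘ g⁻¹` on the tower points, `col z' = (1 + X)·col z`.
Hence `col` is linear for the `Λ_𝒪`-structure `(1+T)·z := z ∘ g⁻¹` on functionals and `Hom(E(ℚ_{2,∞}·ℚ_v), 𝒪)/ann(E⁺_∞) ≅ Λ_𝒪` as
`Λ_𝒪`-modules (Kobayashi Thm. 6.2 with coefficients, `p = 2`). Proof: §1 at the orbit of `d_{2m}` (`g^{4^m} d_{2m} = d_{2m}`,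
`ω_{2m} = (X+1)^{4^m} − 1`) and the pinning clause. [cite: Kobayashi2003, Thm. 6.2 (6.13) (p. 12), §8 (8.20)–(8.23)]
[cite: Sprung2012, §5 Def. 5.9, Prop. 7.3] -/
theorem exists_colemanPlusHom_coeff_two_twist (hss : GoodSS W 2) (ha : W.frobeniusTrace 2 = 0) (κ : ZpExtension ℚ 2)
    (hκ : κ.IsCyclotomic) (v : HeightOneSpectrum (𝓞 ℚ)) (hv : (2 : 𝓞 ℚ) ∈ v.asIdeal) :
    ∃ (g : Field.absoluteGaloisGroup (v.adicCompletion ℚ)) (d : ℕ → localPoints W (v.adicCompletion ℚ))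
      (hdA : ∀ m j, g ^ j • d m ∈ Sprung2012.localTowerPointsOfEmb κ (closureEmb (K := ℚ) (v.adicCompletion ℚ)) W),
      κ.IsTopGenerator (resGalOfEmb (closureEmb (K := ℚ) (v.adicCompletion ℚ)) g) ∧
      (∀ m, d m ∈ localLayerPointsOfEmb κ (closureEmb (K := ℚ) (v.adicCompletion ℚ)) W m) ∧
      (∀ m, localTraceOfEmb κ (closureEmb (K := ℚ) (v.adicCompletion ℚ)) W (m + 1) (m + 2) (d (m + 2)) = -d m) ∧
      (∀ b ∈ localLayerPointsOfEmb κ (closureEmb (K := ℚ) (v.adicCompletion ℚ)) W 0, d 0 ≠ 2 • b) ∧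
      ∀ (O : Type) [CommRing O] [IsDomain O] [Algebra ℤ_[2] O] [Module.Free ℤ_[2] O] [Module.Finite ℤ_[2] O],
        ∃ col : (Sprung2012.localTowerPointsOfEmb κ (closureEmb (K := ℚ) (v.adicCompletion ℚ)) W →+ O) →ₗ[O] PowerSeries O,
          (∀ (z : Sprung2012.localTowerPointsOfEmb κ (closureEmb (K := ℚ) (v.adicCompletion ℚ)) W →+ O) (m : ℕ),
            (((cyclotomicOmega 2 (2 * m)).map (Int.castRingHom O) : O[X]) : PowerSeries O) ∣
              ((∑ j ∈ range (2 ^ (2 * m)), C (z ⟨g ^ j • d (2 * m), hdA (2 * m) j⟩) * (X + 1) ^ j : O[X]) : PowerSeries O) +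
                (-1 : PowerSeries O) ^ m * (((cyclotomicOmegaMinus 2 (2 * m)).map (Int.castRingHom O) : O[X]) : PowerSeries O) * col z) ∧
          (∀ (z : Sprung2012.localTowerPointsOfEmb κ (closureEmb (K := ℚ) (v.adicCompletion ℚ)) W →+ O) (L : PowerSeries O),
            (∀ m : ℕ, (((cyclotomicOmega 2 (2 * m)).map (Int.castRingHom O) : O[X]) : PowerSeries O) ∣
              ((∑ j ∈ range (2 ^ (2 * m)), C (z ⟨g ^ j • d (2 * m), hdA (2 * m) j⟩) * (X + 1) ^ j : O[X]) : PowerSeries O) +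
                (-1 : PowerSeries O) ^ m * (((cyclotomicOmegaMinus 2 (2 * m)).map (Int.castRingHom O) : O[X]) : PowerSeries O) * L) →
            L = col z) ∧
          Surjective col ∧
          (∀ z : Sprung2012.localTowerPointsOfEmb κ (closureEmb (K := ℚ) (v.adicCompletion ℚ)) W →+ O,
            col z = 0 ↔ ∀ (n : ℕ) (x : localPoints W (v.adicCompletion ℚ))
              (hx : x ∈ signedLocalPoints κ (v.adicCompletion ℚ) W 1 n),
              z ⟨x, Sprung2012.localLayerPointsOfEmb_le_localTowerPointsOfEmb κ _ W n (signedLocalPointsOfEmb_le κ _ W 1 n hx)⟩ = 0) ∧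
          (∀ (z z' : Sprung2012.localTowerPointsOfEmb κ (closureEmb (K := ℚ) (v.adicCompletion ℚ)) W →+ O),
            (∀ a : Sprung2012.localTowerPointsOfEmb κ (closureEmb (K := ℚ) (v.adicCompletion ℚ)) W,
              z' a = z ⟨g⁻¹ • (a : localPoints W (v.adicCompletion ℚ)),
                Sprung2012.smul_mem_localTowerPointsOfEmb κ _ W g⁻¹ a.2⟩) →
            col z' = (1 + PowerSeries.X) * col z) := by
  obtain ⟨g, d, hdA, hg, hd, htr, hND, hO⟩ := exists_colemanPlusHom_coeff_two W hss ha κ hκ v hv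
  refine ⟨g, d, hdA, hg, hd, htr, hND, fun O _ _ _ _ _ ↦ ?_⟩
  obtain ⟨col, hcong, hpin, hsurj, hker⟩ := hO O
  refine ⟨col, hcong, hpin, hsurj, hker, fun z z' hz' ↦ (hpin z' _ fun m ↦ ?_).symm⟩
  -- the orbit of `d_{2m}`: `g^{4^m} • d_{2m} = d_{2m}`, `ω_{2m} = (X+1)^{4^m} − 1`
  have hfix : g ^ 2 ^ (2 * m) • d (2 * m) = d (2 * m) := by
    simpa using Sprung2012.pow_mul_smul_of_mem_localLayerPointsOfEmb κ (closureEmb (K := ℚ) (v.adicCompletion ℚ)) W hg (hd (2 * m)) 1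
  have hω : (((cyclotomicOmega 2 (2 * m)).map (Int.castRingHom O) : O[X]) : PowerSeries O) =
      (((X + 1) ^ 2 ^ (2 * m) - 1 : O[X]) : PowerSeries O) := by
    rw [map_cyclotomicOmega]
  rw [hω]
  exact plusCongr_precomp_inv (Sprung2012.localTowerPointsOfEmb κ (closureEmb (K := ℚ) (v.adicCompletion ℚ)) W)
    (fun σ a ha ↦ Sprung2012.smul_mem_localTowerPointsOfEmb κ _ W σ ha) g (pow_pos two_pos _) (d (2 * m)) hfix (hdA (2 * m))
    z z' hz' _ (col z) (by have := hcong z m; rwa [hω] at this)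

end Two

end Summit.BirchSwinnertonDyer.BirchSwinnertonDyer.Theorems.SignedColemanImage

end
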